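/-
Copyright (c) 2026 The H21 project. Released under Apache 2.0 license.
-/
import Summits.RiemannHypothesis.RiemannHypothesis.Theorems.PfPersistenceGalerkinNegIndexApprox
import Summits.RiemannHypothesis.RiemannHypothesis.Theorems.PfPersistenceM2EvenSectorIndexExact
import HarnessLib

/-!
# `P_F` persistence — GAL-3: the continuum negative even index TRANSFERS INTO the Galerkin tower (cand-3, gen 10)

Mechanism / rigidity campaign of the `pub-rhpf` cell (variational seat M2 = cand-3); NO claim about RH is made
anywhere in this file.  Everything here is RH-free and sorry-free; no numerical datum is used (all PROVED).

`PfPersistenceGalerkinNegIndexForms` typed the Galerkin-side negative index `GalerkinNegIndexAtLeast d n win`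
(an `n`-dimensional negative-definite subspace of the window form; levels 1 and 2 for `ζ` are `ε₁^{(N)}(a) < 0`
and `ε₂^{(N)}(a) < 0`).  The M2 seat's `EvenNegIndexAtLeast n a` (`PfPersistenceM2EvenSectorIndexExact`) is the
CONTINUUM index — `n` smooth even real tests on `[-a, a]` spanning a negative-definite subspace of `Re Q` — and
its exact theorem reads it off the off-line quadrant `𝒬 = {ρ : ζ(ρ) = 0, Re ρ > 1/2, Im ρ > 0}`.

MAIN THEOREM (§4, `exists_galerkinNegIndexAtLeast_of_evenNegIndexAtLeast`):
`EvenNegIndexAtLeast n a → ∃ N, GalerkinNegIndexAtLeast ζ n (a, N)`, and then at every larger `N` (nesting): the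
Galerkin tower SEES the whole continuum negative index, level by level, on EXPLICIT window vectors (the
Fejér–Galerkin vectors).  Proof: the approximant of `∑ cᵢ gᵢ` is `∑ cᵢ`·(approximant of `gᵢ`) (linearity,
`…Approx` §2), GAL-1's `tendsto_markovClosedForm` runs at SYNCHRONISED levels for every coefficient vector `c`
(`…Approx` §3 supplies one Lipschitz constant and eventual sup-closeness per test), and the finite-dimensional
lemma `eventually_negDef_of_tendsto` upgrades pointwise convergence of the forms to negative definiteness.

READINGS (§5): `EvenNegIndexAtLeast 1 a ⇒ ε₁^{(N)}(a) < 0` and `EvenNegIndexAtLeast 2 a ⇒ ε₂^{(N)}(a) < 0` for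
all large `N`; with the M2 index theorem: `𝒬` finite with `#𝒬 ≥ 2 ⇒` every long window has `ε₂^{(N)}(a) < 0`
at all large `N`; `n ≤ #𝒬 ⇒` some window carries Galerkin negative index `≥ n`; contrapositively a
window-uniformly non-negative SECOND Galerkin level leaves `𝒬` infinite or `#𝒬 ≤ 1` — strictly weaker than RH
and blind to `K = 1`, exactly as the M2 census records for the continuum.  The converse transfer at level `≥ 2`
(Galerkin ⇒ continuum) is NOT claimed: it needs a LINEAR smooth mollifier of window vectors with cross-term
control, which the tree's per-vector existential `exists_even_mollified_seq` does not provide.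
-/

set_option linter.dupNamespace false

noncomputable section

open Set Matrix Finset Filter MeasureTheory
open scoped Topology

namespace Summit.RiemannHypothesis.RiemannHypothesis.Theorems.PfPersistence

open Literature.NumberTheory.LFunctions
open Literature.NumberTheory.LFunctions.ZetaZeros
open Summit.RiemannHypothesis.RiemannHypothesis.Theorems.PfPersistenceM2NegIndex
open FejerProfile TestDensity Real

/-! ## §4 The transfer: continuum negative index ⟹ Galerkin negative index -/

/-- **PROVED (GAL-3) — THE CONTINUUM NEGATIVE EVEN INDEX IS SEEN BY THE GALERKIN TOWER.**  If `n` smooth even real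
tests on `[-a, a]` span a negative-definite subspace of `Re Q` (`EvenNegIndexAtLeast n a`, M2 seat), then at SOME
truncation `N` the even block of `ζ` at `(a, N)` is negative definite on the span of their level-`N`
Fejér–Galerkin vectors: `GalerkinNegIndexAtLeast ζ n (a, N)`.  Mechanism: the approximants of a combination are
the combinations of the approximants (§2), GAL-1's `tendsto_markovClosedForm` runs along SYNCHRONISED levels for
every coefficient vector, and §1 upgrades pointwise convergence of the Gram-type forms to negative definiteness.
RH-free. [folklore] -/
theorem exists_galerkinNegIndexAtLeast_of_evenNegIndexAtLeast {n : ℕ} {a : ℝ} (ha : 0 < a)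
    (h : EvenNegIndexAtLeast n a) : ∃ N : ℕ, GalerkinNegIndexAtLeast zetaDatum n ⟨a, N, ha⟩ := by
  obtain ⟨g, hgt, hge, hgr, hgs, hneg⟩ := h
  choose K hK0 hlip hsup using fun i ↦ fejerGalerkin_approx ha (hgt i) (hgs i) (hge i) (hgr i)
  have hpos : ∀ k : ℕ, (0 : ℝ) < 1 / ((k : ℝ) + 1) := fun k ↦ by positivity
  choose M₀ hM₀ using fun (i : Fin n) (k : ℕ) ↦ hsup i (1 / ((k : ℝ) + 1)) (hpos k)
  -- synchronised levels `L k ≥ M₀ i k` for every `i`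
  set L : ℕ → ℕ := fun k ↦ ∑ i, M₀ i k with hLdef
  have hLge : ∀ i k, M₀ i k ≤ L k := fun i k ↦
    Finset.single_le_sum (f := fun j ↦ M₀ j k) (fun j _ ↦ Nat.zero_le _) (mem_univ i)
  set v : (k : ℕ) → Fin n → Fin (L k + 1) → ℝ := fun k i ↦ fejerGalerkinVec a (g i) (L k) with hvdef
  set B : ℕ → Matrix (Fin n) (Fin n) ℝ := fun k ↦ formMatrix (zetaDatum ⟨a, L k, ha⟩) (v k) with hBdef
  set G : (Fin n → ℝ) → ℝ := fun c ↦ (weilQuadratic (fun t : ℝ ↦ ∑ i, (c i : ℂ) * g i t)).re with hGdef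
  have hconv : ∀ c, Tendsto (fun k ↦ c ⬝ᵥ (B k *ᵥ c)) atTop (𝓝 (G c)) := by
    intro c
    -- the combination
    set gc : ℝ → ℂ := fun t ↦ ∑ i, (c i : ℂ) * g i t with hgcdef
    have hgct : IsWeilTest gc := isWeilTest_finset_sum univ fun i _ ↦ (hgt i).const_mul _
    have hgcz : ∀ t, t ∉ Icc (-a) a → gc t = 0 := fun t ht ↦ by
      simp only [hgcdef]
      exact sum_eq_zero fun i _ ↦ by
        rw [image_eq_zero_of_notMem_tsupport (fun h' ↦ ht (hgs i h')), mul_zero]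
    have hgcs : tsupport gc ⊆ Icc (-a) a :=
      closure_minimal (fun t ht ↦ by_contra fun h' ↦ ht (hgcz t h')) isClosed_Icc
    -- its approximants are the combinations of the approximants
    set f : ℕ → ℝ → ℂ := fun k ↦ cutoffProfile ⟨a, L k, ha⟩ (∑ i, c i • v k i) with hfdef
    have hfpt : ∀ k x, f k x = ∑ i, (c i : ℂ) * cutoffProfile ⟨a, L k, ha⟩ (v k i) x :=
      fun k x ↦ cutoffProfile_sum_smul ⟨a, L k, ha⟩ c (v k) x
    set C : ℝ := ∑ i, |c i| with hCdef
    have hC0 : 0 ≤ C := sum_nonneg fun i _ ↦ abs_nonneg _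
    have herr : ∀ k x, ‖f k x - gc x‖ ≤ C / ((k : ℝ) + 1) := by
      intro k x
      have e : f k x - gc x = ∑ i, (c i : ℂ) * (cutoffProfile ⟨a, L k, ha⟩ (v k i) x - g i x) := by
        rw [hfpt]
        simp only [hgcdef, mul_sub, sum_sub_distrib]
      rw [e, hCdef, sum_div]
      refine (norm_sum_le _ _).trans (sum_le_sum fun i _ ↦ ?_)
      rw [norm_mul, Complex.norm_real, Real.norm_eq_abs, div_eq_mul_one_div]
      exact mul_le_mul_of_nonneg_left (hM₀ i k (L k) (hLge i k) x) (abs_nonneg _)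
    set Kc : ℝ := ∑ i, |c i| * K i with hKcdef
    have hKc0 : 0 ≤ Kc := sum_nonneg fun i _ ↦ mul_nonneg (abs_nonneg _) (hK0 i)
    have hlipc : ∀ k, ∀ x ∈ Icc (-a) a, ∀ y ∈ Icc (-a) a,
        ‖(f k x - gc x) - (f k y - gc y)‖ ≤ Kc * |x - y| := by
      intro k x hx y hy
      have e : (f k x - gc x) - (f k y - gc y) = ∑ i, (c i : ℂ) *
          ((cutoffProfile ⟨a, L k, ha⟩ (v k i) x - g i x) - (cutoffProfile ⟨a, L k, ha⟩ (v k i) y - g i y)) := by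
        rw [hfpt, hfpt]
        simp only [hgcdef, mul_sub, sum_sub_distrib]
      rw [e, hKcdef, sum_mul]
      refine (norm_sum_le _ _).trans (sum_le_sum fun i _ ↦ ?_)
      rw [norm_mul, Complex.norm_real, Real.norm_eq_abs, mul_assoc]
      exact mul_le_mul_of_nonneg_left (hlip i (L k) x hx y hy) (abs_nonneg _)
    -- shift the sequence so that the sup errors are `≤ 1`
    set k₁ : ℕ := ⌈C⌉₊ with hk₁def
    have hk₁ : C ≤ k₁ := Nat.le_ceil C
    set ε : ℕ → ℝ := fun k ↦ (C + 1) / (((k + k₁ : ℕ) : ℝ) + 1) with hεdef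
    have hε0 : ∀ k, 0 < ε k := fun k ↦ by positivity
    have hε1 : ∀ k, ε k ≤ 1 := fun k ↦ by
      have hk : (0 : ℝ) ≤ k := k.cast_nonneg
      rw [hεdef, div_le_one (by positivity)]
      push_cast
      linarith
    have hεt : Tendsto ε atTop (𝓝 0) := by
      have h1 := (tendsto_one_div_add_atTop_nhds_zero_nat.comp (tendsto_add_atTop_nat k₁)).const_mul (C + 1)
      rw [mul_zero] at h1
      refine h1.congr fun k ↦ ?_
      simp only [hεdef, Function.comp_apply]
      ring
    have hsup' : ∀ k x, ‖f (k + k₁) x - gc x‖ ≤ ε k := fun k x ↦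
      (herr (k + k₁) x).trans (div_le_div_of_nonneg_right (by linarith) (by positivity))
    obtain ⟨-, hclosed⟩ := tendsto_markovClosedForm ha hKc0 hgct hgcs (f := fun k ↦ f (k + k₁))
      (fun k ↦ memLp_cutoffProfile _ _) (fun k x hx ↦ cutoffProfile_eq_zero_of_not_mem _ _ hx) hε0 hε1 hεt hsup'
      (fun k ↦ hlipc (k + k₁))
    -- identify the terms: closed form of the approximant = Gram form; closed form of `gc` = `Re Q(gc)`
    have hterm : ∀ k, markovClosedForm a (f k) = c ⬝ᵥ (B k *ᵥ c) := fun k ↦ by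
      show markovClosedForm a (cutoffProfile ⟨a, L k, ha⟩ (∑ i, c i • v k i)) =
        c ⬝ᵥ (formMatrix (zetaDatum ⟨a, L k, ha⟩) (v k) *ᵥ c)
      rw [← form_sum_smul]
      exact (galerkinForm_eq_markovClosedForm ⟨a, L k, ha⟩ _).symm
    have hlim : markovClosedForm a gc = G c := (re_weilQuadratic_eq_markovClosedForm hgct hgcs).symm
    rw [hlim] at hclosed
    simp_rw [hterm] at hclosed
    exact (tendsto_add_atTop_iff_nat k₁).1 hclosed
  obtain ⟨k₀, hk₀⟩ := eventually_negDef_of_tendsto B G hconv fun c hc ↦ hneg c hc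
  exact ⟨L k₀, v k₀, fun c hc ↦ by rw [form_sum_smul]; exact hk₀ k₀ le_rfl c hc⟩

/-- PROVED: and then at EVERY larger truncation (nesting). [folklore] -/
theorem eventually_galerkinNegIndexAtLeast_of_evenNegIndexAtLeast {n : ℕ} {a : ℝ} (ha : 0 < a)
    (h : EvenNegIndexAtLeast n a) : ∃ N₀ : ℕ, ∀ N : ℕ, N₀ ≤ N → GalerkinNegIndexAtLeast zetaDatum n ⟨a, N, ha⟩ := by
  obtain ⟨N₀, hN₀⟩ := exists_galerkinNegIndexAtLeast_of_evenNegIndexAtLeast ha h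
  exact ⟨N₀, fun N hN ↦ zeta_galerkinNegIndexAtLeast_mono hN hN₀⟩

/-! ## §5 Readings: the two lowest levels, and the arithmetic meaning of `ε₂^{(N)}(a) < 0` -/

/-- **PROVED — LEVEL ONE READING**: one negative even test on `[-a, a]` forces `ε₁^{(N)}(a) < 0` for all large `N`
(the detectably-negative side of the cell's dictionary, now with the explicit Fejér vector). [folklore] -/
theorem eventually_bottomRayleigh_neg_of_evenNegIndexAtLeast_one {a : ℝ} (ha : 0 < a)
    (h : EvenNegIndexAtLeast 1 a) : ∃ N₀ : ℕ, ∀ N : ℕ, N₀ ≤ N → bottomRayleigh (zetaDatum ⟨a, N, ha⟩) < 0 := by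
  obtain ⟨N₀, hN₀⟩ := exists_galerkinNegIndexAtLeast_of_evenNegIndexAtLeast ha h
  exact ⟨N₀, fun N hN ↦ zeta_bottomRayleigh_neg_of_galerkinNegIndexAtLeast_one hN₀ hN⟩

/-- **PROVED — LEVEL TWO READING**: two even real tests on `[-a, a]` spanning a negative-definite plane of `Re Q`
force the SECOND Galerkin level negative, `ε₂^{(N)}(a) < 0`, for all large `N`. [folklore] -/
theorem eventually_secondRayleigh_neg_of_evenNegIndexAtLeast_two {a : ℝ} (ha : 0 < a)
    (h : EvenNegIndexAtLeast 2 a) : ∃ N₀ : ℕ, ∀ N : ℕ, N₀ ≤ N → secondRayleigh (zetaDatum ⟨a, N, ha⟩) < 0 := by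
  obtain ⟨N₀, hN₀⟩ := exists_galerkinNegIndexAtLeast_of_evenNegIndexAtLeast ha h
  exact ⟨N₀ + 1, fun N hN ↦ zeta_secondRayleigh_neg_of_galerkinNegIndexAtLeast_two hN₀ (by omega) (by omega)⟩

/-- **PROVED — THE ARITHMETIC SUFFICIENT CONDITION FOR `ε₂ < 0`** (with the M2 seat's index theorem
`evenNegIndexAtLeast_of_finite`): if the off-line quadrant `𝒬 = {ρ : ζ(ρ) = 0, Re ρ > 1/2, Im ρ > 0}` is finite
with at least TWO elements, then some window and truncation of `ζ`'s Galerkin tower has `ε₂^{(N)}(a) < 0` (indeed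
every long window, at all large `N`).  RH-free; says nothing about `ζ`'s actual values. [folklore] -/
theorem exists_secondRayleigh_neg_of_two_le_card
    (hfin : {ρ : ℂ | ρ ∈ riemannZetaNontrivialZeros ∧ 1 / 2 < ρ.re ∧ 0 < ρ.im}.Finite)
    (h2 : 2 ≤ hfin.toFinset.card) :
    ∃ (A : ℝ) (hA : 0 < A), ∀ (a : ℝ) (ha : A < a), ∃ N₀ : ℕ, ∀ N : ℕ, N₀ ≤ N →
      secondRayleigh (zetaDatum ⟨a, N, hA.trans ha⟩) < 0 := by
  obtain ⟨A, hA⟩ := evenNegIndexAtLeast_of_finite hfin h2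
  refine ⟨max A 1, lt_max_of_lt_right one_pos, fun a ha ↦ ?_⟩
  exact eventually_secondRayleigh_neg_of_evenNegIndexAtLeast_two _ (hA a ((le_max_left _ _).trans ha.le))

/-- **PROVED — the Galerkin tower's negative index on long windows is AT LEAST `K`** (`K = #𝒬 < ∞`): for every
`n ≤ K` some window carries `GalerkinNegIndexAtLeast ζ n`. [folklore] -/
theorem exists_galerkinNegIndexAtLeast_of_le_card
    (hfin : {ρ : ℂ | ρ ∈ riemannZetaNontrivialZeros ∧ 1 / 2 < ρ.re ∧ 0 < ρ.im}.Finite) {n : ℕ}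
    (hn : n ≤ hfin.toFinset.card) :
    ∃ (a : ℝ) (ha : 0 < a) (N : ℕ), GalerkinNegIndexAtLeast zetaDatum n ⟨a, N, ha⟩ := by
  obtain ⟨A, hA⟩ := evenNegIndexAtLeast_of_finite hfin hn
  have hpos : 0 < max A 1 := lt_max_of_lt_right one_pos
  obtain ⟨N, hN⟩ := exists_galerkinNegIndexAtLeast_of_evenNegIndexAtLeast hpos (hA _ (le_max_left _ _))
  exact ⟨max A 1, hpos, N, hN⟩

/-- **PROVED — UNCONDITIONAL READING OF A NON-NEGATIVE SECOND GALERKIN LEVEL**: if `ε₂^{(N)}(a) ≥ 0` at EVERY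
window (`N ≥ 1`), then either infinitely many zeros of `ζ` lie in the open off-line quadrant or there is at most
ONE off-line quadruple (`quadrant_infinite_or_encard_le_one`, M2 seat).  The premise is an all-window statement
and is NOT asserted; the conclusion is strictly weaker than RH (blind to `K = 1`), as the M2 census records.
[folklore] -/
theorem quadrant_infinite_or_encard_le_one_of_secondRayleigh_nonneg
    (h : ∀ win : Window, 0 < win.N → 0 ≤ secondRayleigh (zetaDatum win)) :
    {ρ : ℂ | ρ ∈ riemannZetaNontrivialZeros ∧ 1 / 2 < ρ.re ∧ 0 < ρ.im}.Infinite ∨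
      {ρ : ℂ | ρ ∈ riemannZetaNontrivialZeros ∧ 1 / 2 < ρ.re ∧ 0 < ρ.im}.encard ≤ 1 :=
  quadrant_infinite_or_encard_le_one fun a ha2 ↦ by
    have hpos : 0 < max a 1 := lt_max_of_lt_right one_pos
    obtain ⟨N₀, hN₀⟩ :=
      eventually_secondRayleigh_neg_of_evenNegIndexAtLeast_two hpos (ha2.mono (le_max_left _ _))
    exact absurd (hN₀ (N₀ + 1) (Nat.le_succ _)) (not_lt.2 (h ⟨max a 1, N₀ + 1, hpos⟩ (Nat.succ_pos _)))

/-- **PROVED — finitely many off-line zeros and a window-uniformly non-negative second Galerkin level leave at most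
one off-line quadruple.** [folklore] -/
theorem card_le_one_of_secondRayleigh_nonneg
    (hfin : {ρ : ℂ | ρ ∈ riemannZetaNontrivialZeros ∧ 1 / 2 < ρ.re ∧ 0 < ρ.im}.Finite)
    (h : ∀ win : Window, 0 < win.N → 0 ≤ secondRayleigh (zetaDatum win)) : hfin.toFinset.card ≤ 1 := by
  by_contra hlt
  obtain ⟨A, hA0, hA⟩ := exists_secondRayleigh_neg_of_two_le_card hfin (by omega)
  obtain ⟨N₀, hN₀⟩ := hA (A + 1) (by linarith)
  exact absurd (hN₀ (N₀ + 1) (Nat.le_succ _)) (not_lt.2 (h ⟨A + 1, N₀ + 1, _⟩ (Nat.succ_pos _)))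

end Summit.RiemannHypothesis.RiemannHypothesis.Theorems.PfPersistence
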